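import Mathlib
import Summits.FinalStateConjecture.FinalStateConjecture.Theorems.PhotonSphereChannelsUniformPhotonSphereChannelsRConvolutionBoundsBasic

/-!
# Crux `UniformPhotonSphereChannelsR` (K1R, stmt-FinalStateConjecture-14074), line
# `crum-peeling-recessive-tower` — stub (A2a): elementary convolution bounds for the weight `ω_λ`

The registered stub `stub_convolutionBounds` of the line's skeleton v5.  The uniform majorant
induction on the Taylor coefficients of the recessive Riccati–Crum chain (Theorem A of the line)
measures sequences against the two-regime weight `ω_λ(m) := 1/(m(2λ−1+m))` (`≈ 1/(2λm)` for
`m ≪ λ`, `≈ 1/m²` for `m ≫ λ`) and the profile `1/n²`, and needs exactly five elementary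
inequalities with ABSOLUTE constants, uniform in real `λ ≥ 2` and in the order `n`:

* (CV1) `Σ_{i=2}^{n−1} i⁻² ω(n−i) ≤ 16 ((n−1)/n) ω(n)`;
* (CV2) `Σ_{i=1}^{m−1} ω(i) ω(m−i) ≤ (16/3) ω(m) (1 + log 2λ)/λ`;
* (CV3) `n Σ_{i=1}^{n−1} i⁻¹ ω(n−i) ≤ 4`;
* (CV4) `Σ_{i=2}^{n−1} i⁻²/(2λ−1+n−i) ≤ 3/(2λ−1+n)`;
* (G)   for natural `λ ≥ 2`, `n ≥ 2λ`:
        `3λ/(2λ−1+n) ≤ 2(n−1)/(2λ−1)² + 1 − λ(n+1−2λ)/((λ−1)(2λ−1+n))`.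

Writing `L := 2λ − 1 ≥ 3`, every bound follows from the partial-fraction splittings
`1/(i(n−i)) = (1/n)(1/i + 1/(n−i))`, `1/(L+n−i) = (1/(L+n))(1 + i/(L+n−i))`, the telescoping sums
`Σ_{i≥2} 1/i² ≤ 1`, `Σ_{i≥1} 1/(i(i+1)) ≤ 1`, the logarithmic telescoping
`Σ_{i≥1} 1/(i(L+i)) ≤ 1/(L+1) + log(L+1)/L`, and the reflection `i ↦ n − i`; (G) is a polynomial
inequality with nonnegative coefficients in `(λ − 2, n − 2λ)` after clearing denominators.
Part 1 (`…ConvolutionBoundsBasic`) has the basic sums, (CV3) and (CV4); this file proves (CV1),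
(CV2), (G) and assembles the registered conjunction.
-/

-- `Summit.<S>.<S>` repeats a namespace component by design (D-0017); off here as in the lakefile.
set_option linter.dupNamespace false

noncomputable section

namespace Summit.FinalStateConjecture.FinalStateConjecture.Theorems.CrumPeelingRecessiveTower

open Finset

/-! ### (CV1) -/

/-- (CV1), splitting of one summand:
`i⁻² ω(n−i) = (1/n)·i⁻²/(L+n−i) + (1/(n(L+n)))·(1/(i(n−i)) + ω(n−i))`. -/
theorem convolutionBounds_cv1_term {L n i : ℝ} (hL : 3 ≤ L) (hi : 2 ≤ i) (hin : i + 1 ≤ n) :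
    1 / i ^ 2 * (1 / ((n - i) * (L + (n - i))))
      = 1 / n * (1 / i ^ 2 * (1 / (L + (n - i))))
        + 1 / (n * (L + n)) * (1 / (i * (n - i)))
        + 1 / (n * (L + n)) * (1 / ((n - i) * (L + (n - i)))) := by
  have hi0 : 0 < i := by linarith
  have hni : 0 < n - i := by linarith
  have hp : 0 < L + (n - i) := by linarith
  have hn0 : 0 < n := by linarith
  have hLn : 0 < L + n := by linarith
  field_simp
  ring

/-- `1/(i(n−i)) ≤ 2/n` for `2 ≤ i ≤ n − 1`. -/
theorem convolutionBounds_inv_mul_sub_le {n i : ℝ} (hi : 2 ≤ i) (hin : i + 1 ≤ n) :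
    1 / (i * (n - i)) ≤ 2 / n := by
  have hi0 : 0 < i := by linarith
  have hni : 0 < n - i := by linarith
  rw [div_le_div_iff₀ (by positivity) (by linarith)]
  nlinarith [mul_nonneg (by linarith : (0:ℝ) ≤ i - 1) (by linarith : (0:ℝ) ≤ n - i - 1)]

/-- (CV1) with real subtraction:
`Σ_{i=2}^{n−1} i⁻² ω(n−i) ≤ 16 ((n−1)/n) ω(n)` (`L ≥ 3`, `n ≥ 2`); in fact `≤ 6 ω(n)`. -/
theorem convolutionBounds_cv1_real (L : ℝ) (hL : 3 ≤ L) (n : ℕ) (hn : 2 ≤ n) :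
    ∑ i ∈ Finset.Ico 2 n, (1 / ((i : ℝ) ^ 2))
        * (1 / (((n : ℝ) - (i : ℝ)) * (L + ((n : ℝ) - (i : ℝ)))))
      ≤ 16 * (((n : ℝ) - 1) / n) * (1 / ((n : ℝ) * (L + n))) := by
  have hn' : (2 : ℝ) ≤ n := by exact_mod_cast hn
  have hn0 : (0 : ℝ) < n := by linarith
  have hLn : 0 < L + n := by linarith
  -- split every summand into three pieces
  have hsplit : ∑ i ∈ Finset.Ico 2 n, (1 / ((i : ℝ) ^ 2))
        * (1 / (((n : ℝ) - (i : ℝ)) * (L + ((n : ℝ) - (i : ℝ)))))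
      = 1 / (n : ℝ) * ∑ i ∈ Finset.Ico 2 n, (1 / ((i : ℝ) ^ 2)) * (1 / (L + ((n : ℝ) - (i : ℝ))))
        + 1 / ((n : ℝ) * (L + n)) * ∑ i ∈ Finset.Ico 2 n, (1 / ((i : ℝ) * ((n : ℝ) - (i : ℝ))))
        + 1 / ((n : ℝ) * (L + n))
          * ∑ i ∈ Finset.Ico 2 n, (1 / (((n : ℝ) - (i : ℝ)) * (L + ((n : ℝ) - (i : ℝ))))) := by
    rw [Finset.mul_sum, Finset.mul_sum, Finset.mul_sum, ← Finset.sum_add_distrib,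
      ← Finset.sum_add_distrib]
    refine Finset.sum_congr rfl (fun i hi => ?_)
    rw [Finset.mem_Ico] at hi
    exact convolutionBounds_cv1_term hL (by exact_mod_cast hi.1)
      (by exact_mod_cast Nat.succ_le_of_lt hi.2)
  -- the three pieces
  have h1 : ∑ i ∈ Finset.Ico 2 n, (1 / ((i : ℝ) ^ 2)) * (1 / (L + ((n : ℝ) - (i : ℝ))))
      ≤ 3 / (L + n) := convolutionBounds_cv4_real L hL n hn
  have h2 : ∑ i ∈ Finset.Ico 2 n, (1 / ((i : ℝ) * ((n : ℝ) - (i : ℝ)))) ≤ 2 := by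
    calc ∑ i ∈ Finset.Ico 2 n, (1 / ((i : ℝ) * ((n : ℝ) - (i : ℝ))))
        ≤ ∑ i ∈ Finset.Ico 2 n, (2 / (n : ℝ)) := by
          apply Finset.sum_le_sum
          intro i hi
          rw [Finset.mem_Ico] at hi
          exact convolutionBounds_inv_mul_sub_le (by exact_mod_cast hi.1)
            (by exact_mod_cast Nat.succ_le_of_lt hi.2)
      _ = ((n - 2 : ℕ) : ℝ) * (2 / n) := by rw [Finset.sum_const, Nat.card_Ico, nsmul_eq_mul]
      _ ≤ (n : ℝ) * (2 / n) := by gcongr; exact_mod_cast Nat.sub_le n 2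
      _ = 2 := by field_simp
  have h3 : ∑ i ∈ Finset.Ico 2 n, (1 / (((n : ℝ) - (i : ℝ)) * (L + ((n : ℝ) - (i : ℝ))))) ≤ 1 := by
    rw [convolutionBounds_sum_reflect_two (fun x => 1 / (x * (L + x))) n]
    exact convolutionBounds_sum_omega_le_one L hL _
  rw [hsplit]
  have e1 : 1 / (n : ℝ) * (3 / (L + n)) = 3 * (1 / ((n : ℝ) * (L + n))) := by
    field_simp
  have hW : 0 < 1 / ((n : ℝ) * (L + n)) := by positivity
  have hhalf : (1 : ℝ) / 2 ≤ ((n : ℝ) - 1) / n := by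
    rw [div_le_div_iff₀ (by norm_num) hn0]
    linarith
  calc 1 / (n : ℝ) * ∑ i ∈ Finset.Ico 2 n, (1 / ((i : ℝ) ^ 2)) * (1 / (L + ((n : ℝ) - (i : ℝ))))
        + 1 / ((n : ℝ) * (L + n)) * ∑ i ∈ Finset.Ico 2 n, (1 / ((i : ℝ) * ((n : ℝ) - (i : ℝ))))
        + 1 / ((n : ℝ) * (L + n))
          * ∑ i ∈ Finset.Ico 2 n, (1 / (((n : ℝ) - (i : ℝ)) * (L + ((n : ℝ) - (i : ℝ)))))
      ≤ 1 / (n : ℝ) * (3 / (L + n)) + 1 / ((n : ℝ) * (L + n)) * 2 + 1 / ((n : ℝ) * (L + n)) * 1 := by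
        gcongr
    _ = 6 * (1 / ((n : ℝ) * (L + n))) := by rw [e1]; ring
    _ ≤ 16 * (((n : ℝ) - 1) / n) * (1 / ((n : ℝ) * (L + n))) := by
        nlinarith [mul_le_mul_of_nonneg_left hhalf hW.le]

/-- (CV1) as registered. -/
theorem convolutionBounds_cv1 (lam : ℝ) (n : ℕ) (hlam : 2 ≤ lam) (hn : 2 ≤ n) :
    ∑ i ∈ Finset.Ico 2 n, (1 / ((i : ℝ) ^ 2))
        * (1 / ((((n - i : ℕ) : ℝ)) * (2 * lam - 1 + ((n - i : ℕ) : ℝ))))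
      ≤ 16 * (((n : ℝ) - 1) / n) * (1 / ((n : ℝ) * (2 * lam - 1 + n))) := by
  have hcast : ∑ i ∈ Finset.Ico 2 n, (1 / ((i : ℝ) ^ 2))
        * (1 / ((((n - i : ℕ) : ℝ)) * (2 * lam - 1 + ((n - i : ℕ) : ℝ))))
      = ∑ i ∈ Finset.Ico 2 n, (1 / ((i : ℝ) ^ 2))
        * (1 / (((n : ℝ) - (i : ℝ)) * (2 * lam - 1 + ((n : ℝ) - (i : ℝ))))) := by
    refine Finset.sum_congr rfl (fun i hi => ?_)
    rw [Finset.mem_Ico] at hi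
    rw [Nat.cast_sub hi.2.le]
  rw [hcast]
  exact convolutionBounds_cv1_real (2 * lam - 1) (by linarith) n hn

/-! ### (CV2) -/

/-- (CV2), symmetric splitting of one summand:
`ω(i)ω(m−i) = (1/m)(ω(i)/(L+m−i) + ω(m−i)/(L+i))`, the second term written as the reflection
`i ↦ m − i` of the first. -/
theorem convolutionBounds_cv2_term {L m i : ℝ} (hL : 3 ≤ L) (hi : 1 ≤ i) (him : i + 1 ≤ m) :
    1 / (i * (L + i)) * (1 / ((m - i) * (L + (m - i))))
      = 1 / m * (1 / (i * (L + i)) * (1 / (L + (m - i))))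
        + 1 / m * (1 / ((m - i) * (L + (m - i))) * (1 / (L + (m - (m - i))))) := by
  have hi0 : 0 < i := by linarith
  have hmi : 0 < m - i := by linarith
  have hp : 0 < L + (m - i) := by linarith
  have hLi : 0 < L + i := by linarith
  have hm0 : 0 < m := by linarith
  rw [sub_sub_cancel]
  field_simp
  ring

/-- (CV2), the half summand: `ω(i)/(L+m−i) ≤ (1/(L+m))(ω(i) + 1/((L+1)(L+m−1)))` for
`1 ≤ i ≤ m − 1`, from `1/(L+m−i) = (1/(L+m))(1 + i/(L+m−i))` and
`(L+i)(L+m−i) ≥ (L+1)(L+m−1)`. -/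
theorem convolutionBounds_cv2_termB {L m i : ℝ} (hL : 3 ≤ L) (hi : 1 ≤ i) (him : i + 1 ≤ m) :
    1 / (i * (L + i)) * (1 / (L + (m - i)))
      ≤ 1 / (L + m) * (1 / (i * (L + i))) + 1 / (L + m) * (1 / ((L + 1) * (L + (m - 1)))) := by
  have hi0 : 0 < i := by linarith
  have hmi : 0 < m - i := by linarith
  have hp : 0 < L + (m - i) := by linarith
  have hLi : 0 < L + i := by linarith
  have hm0 : 0 < m := by linarith
  have hLm : 0 < L + m := by linarith
  have key : 1 / (i * (L + i)) * (1 / (L + (m - i)))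
      = 1 / (L + m) * (1 / (i * (L + i))) + 1 / (L + m) * (1 / ((L + i) * (L + (m - i)))) := by
    field_simp
    ring
  rw [key]
  have hU : 1 / ((L + i) * (L + (m - i))) ≤ 1 / ((L + 1) * (L + (m - 1))) := by
    apply one_div_le_one_div_of_le (mul_pos (by linarith) (by linarith))
    nlinarith [mul_nonneg (by linarith : (0:ℝ) ≤ i - 1) (by linarith : (0:ℝ) ≤ m - 1 - i)]
  gcongr

/-- (CV2), the final numerical step: `2W(2/(2λ) + ℓ/(2λ−1)) ≤ (16/3) W (1+ℓ)/λ` for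
`λ ≥ 2`, `W, ℓ ≥ 0`. -/
theorem convolutionBounds_cv2_final {lam W l : ℝ} (hlam : 2 ≤ lam) (hW : 0 ≤ W) (hl : 0 ≤ l) :
    2 * W * (2 / (2 * lam) + l / (2 * lam - 1)) ≤ 16 / 3 * W * (1 + l) / lam := by
  have hlam0 : 0 < lam := by linarith
  have e1 : 2 / (2 * lam) = 1 / lam := by
    field_simp
  have hl' : l / (2 * lam - 1) ≤ l / lam :=
    div_le_div_of_nonneg_left hl hlam0 (by linarith)
  calc 2 * W * (2 / (2 * lam) + l / (2 * lam - 1))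
      ≤ 2 * W * (1 / lam + l / lam) := by rw [e1]; gcongr
    _ = 2 * W * (1 + l) / lam := by ring
    _ ≤ 16 / 3 * W * (1 + l) / lam := by
        apply div_le_div_of_nonneg_right _ hlam0.le
        nlinarith [mul_nonneg hW hl]

/-- (CV2) with real subtraction and in terms of `L = 2λ − 1 ≥ 3`:
`Σ_{i=1}^{m−1} ω(i)ω(m−i) ≤ (2/(m(L+m)))·(2/(L+1) + log(L+1)/L)` for `m ≥ 2`. -/
theorem convolutionBounds_cv2_real (L : ℝ) (hL : 3 ≤ L) (m : ℕ) (hm : 2 ≤ m) :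
    ∑ i ∈ Finset.Ico 1 m, (1 / ((i : ℝ) * (L + (i : ℝ))))
        * (1 / (((m : ℝ) - (i : ℝ)) * (L + ((m : ℝ) - (i : ℝ)))))
      ≤ 2 / ((m : ℝ) * (L + m)) * (2 / (L + 1) + Real.log (L + 1) / L) := by
  have hm' : (2 : ℝ) ≤ m := by exact_mod_cast hm
  have hm0 : (0 : ℝ) < m := by linarith
  have hL0 : 0 < L := by linarith
  have hLm : 0 < L + m := by linarith
  -- symmetric splitting
  have hsplit : ∑ i ∈ Finset.Ico 1 m, (1 / ((i : ℝ) * (L + (i : ℝ))))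
        * (1 / (((m : ℝ) - (i : ℝ)) * (L + ((m : ℝ) - (i : ℝ)))))
      = 1 / (m : ℝ) * ∑ i ∈ Finset.Ico 1 m, (1 / ((i : ℝ) * (L + (i : ℝ))))
            * (1 / (L + ((m : ℝ) - (i : ℝ))))
        + 1 / (m : ℝ) * ∑ i ∈ Finset.Ico 1 m, (1 / (((m : ℝ) - (i : ℝ)) * (L + ((m : ℝ) - (i : ℝ)))))
            * (1 / (L + ((m : ℝ) - ((m : ℝ) - (i : ℝ))))) := by
    rw [Finset.mul_sum, Finset.mul_sum, ← Finset.sum_add_distrib]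
    refine Finset.sum_congr rfl (fun i hi => ?_)
    rw [Finset.mem_Ico] at hi
    exact convolutionBounds_cv2_term hL (by exact_mod_cast hi.1)
      (by exact_mod_cast Nat.succ_le_of_lt hi.2)
  have hrefl : ∑ i ∈ Finset.Ico 1 m, (1 / (((m : ℝ) - (i : ℝ)) * (L + ((m : ℝ) - (i : ℝ)))))
            * (1 / (L + ((m : ℝ) - ((m : ℝ) - (i : ℝ)))))
      = ∑ i ∈ Finset.Ico 1 m, (1 / ((i : ℝ) * (L + (i : ℝ)))) * (1 / (L + ((m : ℝ) - (i : ℝ)))) :=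
    convolutionBounds_sum_reflect (fun x => (1 / (x * (L + x))) * (1 / (L + ((m : ℝ) - x)))) m
  -- the half sum
  have hA : ∑ i ∈ Finset.Ico 1 m, (1 / ((i : ℝ) * (L + (i : ℝ)))) * (1 / (L + ((m : ℝ) - (i : ℝ))))
      ≤ 1 / (L + m) * (1 / (L + 1) + Real.log (L + 1) / L) + 1 / (L + m) * (1 / (L + 1)) := by
    calc ∑ i ∈ Finset.Ico 1 m, (1 / ((i : ℝ) * (L + (i : ℝ)))) * (1 / (L + ((m : ℝ) - (i : ℝ))))
        ≤ ∑ i ∈ Finset.Ico 1 m, (1 / (L + m) * (1 / ((i : ℝ) * (L + (i : ℝ))))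
            + 1 / (L + m) * (1 / ((L + 1) * (L + ((m : ℝ) - 1))))) := by
          apply Finset.sum_le_sum
          intro i hi
          rw [Finset.mem_Ico] at hi
          exact convolutionBounds_cv2_termB hL (by exact_mod_cast hi.1)
            (by exact_mod_cast Nat.succ_le_of_lt hi.2)
      _ = 1 / (L + m) * ∑ i ∈ Finset.Ico 1 m, (1 / ((i : ℝ) * (L + (i : ℝ))))
            + ((m - 1 : ℕ) : ℝ) * (1 / (L + m) * (1 / ((L + 1) * (L + ((m : ℝ) - 1))))) := by
          rw [Finset.sum_add_distrib, Finset.mul_sum, Finset.sum_const, Nat.card_Ico, nsmul_eq_mul]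
      _ ≤ 1 / (L + m) * (1 / (L + 1) + Real.log (L + 1) / L) + 1 / (L + m) * (1 / (L + 1)) := by
          have hS := convolutionBounds_sum_omega_le L hL0 m
          have hq : ((m : ℝ) - 1) / ((L + 1) * (L + ((m : ℝ) - 1))) ≤ 1 / (L + 1) := by
            rw [div_le_div_iff₀ (mul_pos (by linarith) (by linarith)) (by linarith)]
            nlinarith
          have hcnt : ((m - 1 : ℕ) : ℝ) * (1 / (L + m) * (1 / ((L + 1) * (L + ((m : ℝ) - 1)))))
              ≤ 1 / (L + m) * (1 / (L + 1)) := by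
            rw [Nat.cast_sub (by omega : 1 ≤ m)]
            push_cast
            calc ((m : ℝ) - 1) * (1 / (L + m) * (1 / ((L + 1) * (L + ((m : ℝ) - 1)))))
                = 1 / (L + m) * (((m : ℝ) - 1) / ((L + 1) * (L + ((m : ℝ) - 1)))) := by ring
              _ ≤ 1 / (L + m) * (1 / (L + 1)) := by gcongr
          have h1 : 1 / (L + m) * ∑ i ∈ Finset.Ico 1 m, (1 / ((i : ℝ) * (L + (i : ℝ))))
              ≤ 1 / (L + m) * (1 / (L + 1) + Real.log (L + 1) / L) := by gcongr
          linarith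
  rw [hsplit, hrefl]
  calc 1 / (m : ℝ) * ∑ i ∈ Finset.Ico 1 m, (1 / ((i : ℝ) * (L + (i : ℝ))))
            * (1 / (L + ((m : ℝ) - (i : ℝ))))
        + 1 / (m : ℝ) * ∑ i ∈ Finset.Ico 1 m, (1 / ((i : ℝ) * (L + (i : ℝ))))
            * (1 / (L + ((m : ℝ) - (i : ℝ))))
      ≤ 1 / (m : ℝ) * (1 / (L + m) * (1 / (L + 1) + Real.log (L + 1) / L) + 1 / (L + m) * (1 / (L + 1)))
        + 1 / (m : ℝ)
          * (1 / (L + m) * (1 / (L + 1) + Real.log (L + 1) / L) + 1 / (L + m) * (1 / (L + 1))) := by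
        gcongr
    _ = 2 / ((m : ℝ) * (L + m)) * (2 / (L + 1) + Real.log (L + 1) / L) := by
        field_simp
        ring

/-- (CV2) as registered. -/
theorem convolutionBounds_cv2 (lam : ℝ) (m : ℕ) (hlam : 2 ≤ lam) (hm : 2 ≤ m) :
    ∑ i ∈ Finset.Ico 1 m, (1 / ((i : ℝ) * (2 * lam - 1 + i)))
        * (1 / ((((m - i : ℕ) : ℝ)) * (2 * lam - 1 + ((m - i : ℕ) : ℝ))))
      ≤ (16 / 3) * (1 / ((m : ℝ) * (2 * lam - 1 + m))) * (1 + Real.log (2 * lam)) / lam := by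
  have hL : 3 ≤ 2 * lam - 1 := by linarith
  have hm' : (2 : ℝ) ≤ m := by exact_mod_cast hm
  have hcast : ∑ i ∈ Finset.Ico 1 m, (1 / ((i : ℝ) * (2 * lam - 1 + i)))
        * (1 / ((((m - i : ℕ) : ℝ)) * (2 * lam - 1 + ((m - i : ℕ) : ℝ))))
      = ∑ i ∈ Finset.Ico 1 m, (1 / ((i : ℝ) * (2 * lam - 1 + (i : ℝ))))
        * (1 / (((m : ℝ) - (i : ℝ)) * (2 * lam - 1 + ((m : ℝ) - (i : ℝ))))) := by
    refine Finset.sum_congr rfl (fun i hi => ?_)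
    rw [Finset.mem_Ico] at hi
    rw [Nat.cast_sub hi.2.le]
  rw [hcast]
  have h := convolutionBounds_cv2_real (2 * lam - 1) hL m hm
  rw [show 2 * lam - 1 + 1 = 2 * lam by ring] at h
  refine h.trans ?_
  have hW : 0 ≤ 1 / ((m : ℝ) * (2 * lam - 1 + m)) :=
    le_of_lt (one_div_pos.mpr (mul_pos (by linarith) (by linarith)))
  have hlog : 0 ≤ Real.log (2 * lam) := Real.log_nonneg (by linarith)
  rw [show 2 / ((m : ℝ) * (2 * lam - 1 + m)) = 2 * (1 / ((m : ℝ) * (2 * lam - 1 + m))) by ring]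
  exact convolutionBounds_cv2_final hlam hW hlog

/-! ### (G) the room inequality -/

/-- (G) over the reals: for `x ≥ 2`, `y ≥ 2x`,
`3x/(2x−1+y) ≤ 2(y−1)/(2x−1)² + 1 − x(y+1−2x)/((x−1)(2x−1+y))`.  After the substitution
`x = s + 2`, `y = 2x + t` and clearing the positive denominators the difference is a polynomial in
`(s, t)` with nonnegative coefficients. -/
theorem convolutionBounds_room_real {x y : ℝ} (hx : 2 ≤ x) (hy : 2 * x ≤ y) :
    3 * x / (2 * x - 1 + y)
      ≤ 2 * (y - 1) / (2 * x - 1) ^ 2 + 1 - x * (y + 1 - 2 * x) / ((x - 1) * (2 * x - 1 + y)) := by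
  obtain ⟨s, hs, rfl⟩ : ∃ s : ℝ, 0 ≤ s ∧ x = s + 2 := ⟨x - 2, by linarith, by ring⟩
  obtain ⟨t, ht, rfl⟩ : ∃ t : ℝ, 0 ≤ t ∧ y = 2 * (s + 2) + t := ⟨y - 2 * (s + 2), by linarith, by ring⟩
  have hD : (0 : ℝ) < 2 * (s + 2) - 1 + (2 * (s + 2) + t) := by linarith
  have hL : (0 : ℝ) < 2 * (s + 2) - 1 := by linarith
  have ha : (0 : ℝ) < s + 2 - 1 := by linarith
  rw [← sub_nonneg]
  have key : 2 * (2 * (s + 2) + t - 1) / (2 * (s + 2) - 1) ^ 2 + 1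
        - (s + 2) * (2 * (s + 2) + t + 1 - 2 * (s + 2)) / ((s + 2 - 1) * (2 * (s + 2) - 1 + (2 * (s + 2) + t)))
        - 3 * (s + 2) / (2 * (s + 2) - 1 + (2 * (s + 2) + t))
      = (33 + 11 * t + 2 * t ^ 2 + 91 * s + 20 * s * t + 2 * s * t ^ 2 + 85 * s ^ 2
          + 8 * s ^ 2 * t + 32 * s ^ 3 + 4 * s ^ 4)
        / ((s + 2 - 1) * (2 * (s + 2) - 1) ^ 2 * (2 * (s + 2) - 1 + (2 * (s + 2) + t))) := by
    field_simp
    ring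
  rw [key]
  positivity

/-- (G) as registered (natural `λ ≥ 2`, `n ≥ 2λ`). -/
theorem convolutionBounds_room (lam n : ℕ) (hlam : 2 ≤ lam) (hn : 2 * lam ≤ n) :
    3 * (lam : ℝ) / (2 * (lam : ℝ) - 1 + n)
      ≤ 2 * ((n : ℝ) - 1) / (2 * (lam : ℝ) - 1) ^ 2 + 1
        - (lam : ℝ) * ((n : ℝ) + 1 - 2 * lam) / (((lam : ℝ) - 1) * (2 * (lam : ℝ) - 1 + n)) :=
  convolutionBounds_room_real (by exact_mod_cast hlam) (by exact_mod_cast hn)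

/-! ### The registered stub -/

/-- **Stub (A2a) `stub_convolutionBounds`** of the line `crum-peeling-recessive-tower`: the five
elementary inequalities (CV1)–(CV4), (G) for the weight `ω_λ(m) = 1/(m(2λ−1+m))`, with absolute
constants `16, 16/3, 4, 3`, uniform in real `λ ≥ 2` and in the order. -/
theorem stub_convolutionBounds :
    (∀ (lam : ℝ) (n : ℕ), 2 ≤ lam → 2 ≤ n →
        ∑ i ∈ Finset.Ico 2 n, (1 / ((i : ℝ) ^ 2)) * (1 / ((((n - i : ℕ) : ℝ)) * (2 * lam - 1 + ((n - i : ℕ) : ℝ))))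
          ≤ 16 * (((n : ℝ) - 1) / n) * (1 / ((n : ℝ) * (2 * lam - 1 + n)))) ∧
    (∀ (lam : ℝ) (m : ℕ), 2 ≤ lam → 2 ≤ m →
        ∑ i ∈ Finset.Ico 1 m, (1 / ((i : ℝ) * (2 * lam - 1 + i))) * (1 / ((((m - i : ℕ) : ℝ)) * (2 * lam - 1 + ((m - i : ℕ) : ℝ))))
          ≤ (16 / 3) * (1 / ((m : ℝ) * (2 * lam - 1 + m))) * (1 + Real.log (2 * lam)) / lam) ∧
    (∀ (lam : ℝ) (n : ℕ), 2 ≤ lam → 1 ≤ n →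
        (n : ℝ) * ∑ i ∈ Finset.Ico 1 n, (1 / (i : ℝ)) * (1 / ((((n - i : ℕ) : ℝ)) * (2 * lam - 1 + ((n - i : ℕ) : ℝ)))) ≤ 4) ∧
    (∀ (lam : ℝ) (n : ℕ), 2 ≤ lam → 2 ≤ n →
        ∑ i ∈ Finset.Ico 2 n, (1 / ((i : ℝ) ^ 2)) * (1 / (2 * lam - 1 + ((n - i : ℕ) : ℝ))) ≤ 3 / (2 * lam - 1 + n)) ∧
    (∀ (lam n : ℕ), 2 ≤ lam → 2 * lam ≤ n →
        3 * (lam : ℝ) / (2 * (lam : ℝ) - 1 + n)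
          ≤ 2 * ((n : ℝ) - 1) / (2 * (lam : ℝ) - 1) ^ 2 + 1
            - (lam : ℝ) * ((n : ℝ) + 1 - 2 * lam) / (((lam : ℝ) - 1) * (2 * (lam : ℝ) - 1 + n))) :=
  ⟨convolutionBounds_cv1, convolutionBounds_cv2, convolutionBounds_cv3, convolutionBounds_cv4,
    convolutionBounds_room⟩

end Summit.FinalStateConjecture.FinalStateConjecture.Theorems.CrumPeelingRecessiveTower

end
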